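import Summits.Ventures.PercRepro.SevenThreeLineFibre
import Summits.Ventures.PercRepro.SevenThreeStarBound

/-!
# PercRepro — the `(7,3)` cell: the series classes on a line (p3, gen 16)

Two facts about dependent subsets `C` of the world (`two_le_card_inter_W_of_dep`: at least two points of `W`, else
`C ⊆ T` or its single `W`-point is spanned by `C ∩ T ⊆ T`; `one_le_card_inter_T_of_dep`: `C` meets `T`), and the
traces of the series classes of the world on a finset `A ⊆ K(E)` (`lineTraces`, listed by decreasing size in
`lineClassList`): pairwise disjoint with union `A`, and a subset `Z₁ ⊆ A` has dual rank `≥ 2` iff it meets at least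
two traces (`two_le_hitsL_iff`) — the `hit` count of the line table (`P3-C025-seven-three-plan.md` §9 (R3)(a)).
-/

namespace PercRepro

namespace SevenThree

open Finset ThmH SixThree CycCount LineCount StarApply

variable {α : Type*} [DecidableEq α] {M : Matroid α} [M.Finite]

/-- A dependent subset of the world has at least two points of `W` (else `C ⊆ T`, or its single `W`-point is
spanned by `C ∩ T ⊆ T`). -/
theorem two_le_card_inter_W_of_dep {T W C : Finset α} (h : ReducedWorld M T W) (hC : C ⊆ T ∪ W)
    (hdep : nrk M C < C.card) : 2 ≤ (C ∩ W).card := by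
  by_contra hlt
  rcases Nat.lt_or_ge (C ∩ W).card 1 with h0 | h1
  · have h0' : C ∩ W = ∅ := Finset.card_eq_zero.1 (by omega)
    have hCT : C ⊆ T := by
      intro e he
      rcases Finset.mem_union.1 (hC he) with hh | hh
      · exact hh
      · have : e ∈ C ∩ W := Finset.mem_inter.2 ⟨he, hh⟩
        rw [h0'] at this
        exact absurd this (Finset.notMem_empty e)
    rw [nrk_subset_T h hCT] at hdep
    omega
  · obtain ⟨w, hw⟩ := Finset.card_eq_one.1 (by omega : (C ∩ W).card = 1)
    have hwC : w ∈ C ∩ W := by rw [hw]; exact Finset.mem_singleton_self w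
    rw [Finset.mem_inter] at hwC
    have hCsplit : C = insert w (C ∩ T) := by
      ext e
      simp only [Finset.mem_insert, Finset.mem_inter]
      constructor
      · intro he
        rcases Finset.mem_union.1 (hC he) with hh | hh
        · exact Or.inr ⟨he, hh⟩
        · left
          have : e ∈ C ∩ W := Finset.mem_inter.2 ⟨he, hh⟩
          rw [hw, Finset.mem_singleton] at this
          exact this
      · rintro (rfl | ⟨he, -⟩)
        · exact hwC.1
        · exact he
    have hwT : w ∉ C ∩ T := fun hh => Finset.disjoint_left.1 h.disj (Finset.mem_inter.1 hh).2 hwC.2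
    have hrkT : nrk M (C ∩ T) = (C ∩ T).card := nrk_subset_T h Finset.inter_subset_right
    have hcard : C.card = (C ∩ T).card + 1 := by
      conv_lhs => rw [hCsplit]
      rw [Finset.card_insert_of_notMem hwT]
    have hmono : nrk M (C ∩ T) ≤ nrk M C := nrk_mono Finset.inter_subset_left
    have hcl : w ∈ M.closure ((C ∩ T : Finset α) : Set α) := by
      by_contra hcl
      have := eRk_insert_eq_succ_of_notMem_closure (h.W_sub hwC.2) hcl
      rw [← hCsplit, ← coe_nrk, ← coe_nrk] at this
      have h3 : nrk M C = nrk M (C ∩ T) + 1 := by exact_mod_cast this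
      omega
    exact h.flat w hwC.2 (M.closure_subset_closure (Finset.coe_subset.2 Finset.inter_subset_right) hcl)

/-- A dependent subset of the world meets `T`. -/
theorem one_le_card_inter_T_of_dep {T W C : Finset α} (h : ReducedWorld M T W) (hC : C ⊆ T ∪ W)
    (hdep : nrk M C < C.card) : 1 ≤ (C ∩ T).card := by
  by_contra hlt
  have h0 : C ∩ T = ∅ := Finset.card_eq_zero.1 (by omega)
  have hCW : C ⊆ W := by
    intro e he
    rcases Finset.mem_union.1 (hC he) with hh | hh
    · have : e ∈ C ∩ T := Finset.mem_inter.2 ⟨he, hh⟩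
      rw [h0] at this
      exact absurd this (Finset.notMem_empty e)
    · exact hh
  rw [nrk_subset_W h hCW] at hdep
  omega

/-- The traces of the series classes of the world on a finset `A`. -/
noncomputable def lineTraces (M : Matroid α) [M.Finite] (T W A : Finset α) : Finset (Finset α) :=
  ((serClasses M (T ∪ W)).filter (fun N => (N ∩ A).Nonempty)).image (fun N => N ∩ A)

/-- The trace list, sorted by decreasing size. -/
noncomputable def lineClassList (M : Matroid α) [M.Finite] (T W A : Finset α) : List (Finset α) :=
  (lineTraces M T W A).toList.mergeSort (fun a b => decide (b.card ≤ a.card))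

/-- Membership in `lineTraces`. -/
theorem mem_lineTraces {T W A tr : Finset α} :
    tr ∈ lineTraces M T W A ↔ ∃ N ∈ serClasses M (T ∪ W), (N ∩ A).Nonempty ∧ N ∩ A = tr := by
  unfold lineTraces
  rw [Finset.mem_image]
  constructor
  · rintro ⟨N, hN, rfl⟩
    rw [Finset.mem_filter] at hN
    exact ⟨N, hN.1, hN.2, rfl⟩
  · rintro ⟨N, hN, hne, rfl⟩
    exact ⟨N, Finset.mem_filter.2 ⟨hN, hne⟩, rfl⟩

/-- `lineClassList` is a permutation of the traces. -/
theorem lineClassList_perm (T W A : Finset α) : (lineClassList M T W A).Perm (lineTraces M T W A).toList :=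
  List.mergeSort_perm _ _

/-- Membership in `lineClassList`. -/
theorem mem_lineClassList {T W A tr : Finset α} : tr ∈ lineClassList M T W A ↔ tr ∈ lineTraces M T W A := by
  rw [(lineClassList_perm T W A).mem_iff, Finset.mem_toList]

/-- `lineClassList` has no duplicates. -/
theorem lineClassList_nodup (T W A : Finset α) : (lineClassList M T W A).Nodup :=
  (lineClassList_perm T W A).nodup_iff.2 (Finset.nodup_toList _)

/-- The traces are pairwise disjoint. -/
theorem lineClassList_pairwise {T W A : Finset α} (h : ReducedWorld M T W) :
    (lineClassList M T W A).Pairwise Disjoint := by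
  apply (lineClassList_nodup T W A).pairwise_of_forall_ne
  intro tr htr tr' htr' hne
  obtain ⟨N, hN, -, rfl⟩ := mem_lineTraces.1 (mem_lineClassList.1 htr)
  obtain ⟨N', hN', -, rfl⟩ := mem_lineTraces.1 (mem_lineClassList.1 htr')
  have hNN' : N ≠ N' := fun hh => hne (by rw [hh])
  exact (pairwiseDisjoint_serClasses (world_subset h) hN hN' hNN').mono Finset.inter_subset_left
    Finset.inter_subset_left

/-- The union of the traces is `A` when `A` lies in the cyclic part of the world. -/
theorem unionL_lineClassList {T W A : Finset α} (hA : A ⊆ cyclicPart M (T ∪ W)) :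
    unionL (lineClassList M T W A) = A := by
  rw [unionL_eq_biUnion]
  ext a
  rw [Finset.mem_biUnion]
  constructor
  · rintro ⟨tr, htr, ha⟩
    rw [List.mem_toFinset, mem_lineClassList] at htr
    obtain ⟨N, -, -, rfl⟩ := mem_lineTraces.1 htr
    exact (Finset.mem_inter.1 ha).2
  · intro ha
    refine ⟨serClass M (T ∪ W) a ∩ A, ?_, Finset.mem_inter.2 ⟨mem_serClass_self (hA ha), ha⟩⟩
    rw [List.mem_toFinset, mem_lineClassList, mem_lineTraces]
    exact ⟨serClass M (T ∪ W) a, mem_serClasses.2 ⟨a, hA ha, rfl⟩,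
      ⟨a, Finset.mem_inter.2 ⟨mem_serClass_self (hA ha), ha⟩⟩, rfl⟩

/-- **Two classes met iff dual rank two**: for `Z₁ ⊆ A ⊆ K(E)`, `2 ≤ hitsL (lineClassList A) Z₁ ↔ 2 ≤ drk E Z₁`. -/
theorem two_le_hitsL_iff {T W A Z₁ : Finset α} (h : ReducedWorld M T W) (hA : A ⊆ cyclicPart M (T ∪ W))
    (hZ₁ : Z₁ ⊆ A) : 2 ≤ hitsL (lineClassList M T W A) Z₁ ↔ 2 ≤ drk M (T ∪ W) Z₁ := by
  have hE := world_subset h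
  have hZcyc : Z₁ ⊆ cyclicPart M (T ∪ W) := hZ₁.trans hA
  -- `hitsL` as a finset count
  have hcount : hitsL (lineClassList M T W A) Z₁ =
      ((lineTraces M T W A).filter (fun tr => (Z₁ ∩ tr).Nonempty)).card := by
    unfold hitsL
    rw [← List.toFinset_card_of_nodup ((lineClassList_nodup T W A).filter _), List.toFinset_filter,
      List.toFinset_eq_of_perm _ _ (lineClassList_perm T W A), Finset.toList_toFinset]
    congr 1
    apply Finset.filter_congr
    intro tr _
    simp
  rw [hcount]
  constructor
  · intro h2
    obtain ⟨tr, htr, tr', htr', hne⟩ := Finset.one_lt_card.1 h2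
    rw [Finset.mem_filter] at htr htr'
    obtain ⟨N, hN, -, rfl⟩ := mem_lineTraces.1 htr.1
    obtain ⟨N', hN', -, rfl⟩ := mem_lineTraces.1 htr'.1
    obtain ⟨e, he⟩ := htr.2
    obtain ⟨f, hf⟩ := htr'.2
    rw [Finset.mem_inter, Finset.mem_inter] at he hf
    have hNN' : N ≠ N' := fun hh => hne (by rw [hh])
    have hns : ¬ Ser M (T ∪ W) e f := by
      intro hser
      apply hNN'
      rw [eq_serClass_of_mem hE hN he.2.1, eq_serClass_of_mem hE hN' hf.2.1]
      exact serClass_eq_of_ser hE (hZcyc he.1) (hZcyc hf.1) hser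
    have hef : e ≠ f := fun hh => hns (Or.inl hh)
    exact two_le_drk_of_not_ser hE (hZcyc he.1) he.1 hf.1 hef hns
  · intro h2
    by_contra hlt
    -- every pair of `Z₁` is in series (two non-series points would meet two traces)
    have hmem : ∀ e ∈ Z₁, serClass M (T ∪ W) e ∩ A ∈
        (lineTraces M T W A).filter (fun tr => (Z₁ ∩ tr).Nonempty) := by
      intro e he
      rw [Finset.mem_filter, mem_lineTraces]
      refine ⟨⟨serClass M (T ∪ W) e, mem_serClasses.2 ⟨e, hZcyc he, rfl⟩,
        ⟨e, Finset.mem_inter.2 ⟨mem_serClass_self (hZcyc he), hZ₁ he⟩⟩, rfl⟩,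
        ⟨e, Finset.mem_inter.2 ⟨he, Finset.mem_inter.2 ⟨mem_serClass_self (hZcyc he), hZ₁ he⟩⟩⟩⟩
    have hser : ∀ e ∈ Z₁, ∀ f ∈ Z₁, Ser M (T ∪ W) e f := by
      intro e he f hf
      by_contra hns
      have hcls : serClass M (T ∪ W) e ≠ serClass M (T ∪ W) f := fun hh =>
        hns (ser_of_mem_serClass hE (hZcyc he) (mem_serClass_self (hZcyc he)) (hh ▸ mem_serClass_self (hZcyc hf)))
      have htr : serClass M (T ∪ W) e ∩ A ≠ serClass M (T ∪ W) f ∩ A := by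
        intro hh
        apply hcls
        have he' : e ∈ serClass M (T ∪ W) f ∩ A := by
          rw [← hh]
          exact Finset.mem_inter.2 ⟨mem_serClass_self (hZcyc he), hZ₁ he⟩
        exact (serClass_eq_of_mem hE (hZcyc hf) (Finset.mem_inter.1 he').1)
      have := Finset.one_lt_card.2 ⟨_, hmem e he, _, hmem f hf, htr⟩
      omega
    by_cases hne : Z₁.Nonempty
    · have := drk_eq_one_of_pairwise_ser hE hZcyc hne hser
      omega
    · rw [Finset.not_nonempty_iff_eq_empty] at hne
      subst hne
      rw [drk_empty] at h2
      omega


end SevenThree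

end PercRepro
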